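import Mathlib.Geometry.Manifold.Instances.Sphere
import Mathlib.Analysis.Calculus.ContDiff.WithLp
import Mathlib.Analysis.Calculus.FDeriv.WithLp
import Mathlib.Analysis.Calculus.FDeriv.Pow
import Mathlib.Analysis.SpecialFunctions.ExpDeriv
import Literature.Topology.FourManifolds.ImmersionCriterion
import Literature.Topology.FourManifolds.DehnSurgeryTubularNbhdProofs
import Literature.Geometry.Manifold.CylinderSlice
import HarnessLib

/-!
# The conformal straightening `Φ ∘ ι : M → ℝ⁵` of a cross-section of the round cylinder is a smooth embedding

Stub `stub_conformalEmbedding` of line `conformal-kernel-domination` of the crux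
`CylinderEntropy.SliceIsolation` (`stmt-SmoothPoincare4-7632`), proved with its registered statement
verbatim.

The round cylinder `N = S⁴ × ℝ` is realised as `{z ∈ ℝ⁶ | ∑_{i<5} zᵢ² = 1}` (coordinates
`z (Fin.castSucc i)`, `i : Fin 5`, and the height `z 5`), and `Φ : ℝ⁶ → ℝ⁵`,
`Φ z = e^{z₅} · (z₀, …, z₄)`, restricts to the conformal diffeomorphism `N ≅ ℝ⁵ ∖ {0}` taking the
slices `S⁴ × {c}` to round spheres about `0`.  For a compact `4`-manifold `M` and a smooth embedding
`ι : M → ℝ⁶` (`Manifold.IsSmoothEmbedding (𝓡 4) (𝓡 6) ∞ ι`) with image in `N`, the composite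
`Φ ∘ ι : M → ℝ⁵` is again a smooth embedding (`Manifold.IsSmoothEmbedding (𝓡 4) (𝓡 5) ∞`).  Proof:

* `Φ` is polynomial-exponential, hence `C^∞` on `ℝ⁶` (`contDiff_conformalFun`), so `Φ ∘ ι` is `C^∞`
  (`ContDiff.comp_contMDiff` with `Manifold.IsSmoothEmbedding.contMDiff`);
* `Φ|_N` is injective (`eq_of_conformal_eq`): `e^{a} x = e^{b} y` with `|x| = |y| = 1` forces
  `e^{2a} = e^{2b}`, so `a = b` and `x = y`; and `ι` is injective (`IsEmbedding.injective`);
* the differential is injective: by the chain rule `d(Φ ∘ ι)_x = dΦ_{ι x} ∘ dι_x`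
  (`HasMFDerivAt.comp` with `HasFDerivAt.hasMFDerivAt`); `dι_x` is injective (tree:
  `Literature.Topology.FourManifolds.mfderiv_injective_of_isImmersion`) and its range is tangent to
  `N`: the composite of `ι` with `q z = ∑_{i<5} zᵢ²` is the constant `1`, so `dq_{ι x} ∘ dι_x = 0`,
  i.e. `∑ zᵢ vᵢ = 0` for `v = dι_x w`, `z = ι x` (`fderiv_sumSq_apply`); and
  `(dΦ_z v)ᵢ = e^{z₅} vᵢ + zᵢ e^{z₅} v₅` (`fderiv_conformalFun_apply`) vanishes for all `i < 5` only if
  `vᵢ = -zᵢ v₅`, whence `0 = ∑ zᵢ vᵢ = -v₅ ∑ zᵢ² = -v₅` and then `v = 0`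
  (`eq_zero_of_conformal_differential_eq_zero`);
* an injective `C^∞` map with injective differential on a compact manifold into a Hausdorff one is a
  smooth embedding (tree:
  `Literature.Topology.FourManifolds.isSmoothEmbedding_of_injective_of_injective_mfderiv`,
  Hirsch (1976), Ch. 1 §3 Thm. 3.1).

Everything here is proved; no facts and no `Prop`-valued definitions are introduced.  Pattern of
`Literature.Geometry.Manifold.CylinderSlice.isSmoothEmbedding_sliceMap` (the slices themselves).
-/

noncomputable section

open scoped Manifold ContDiff Topology
open Set Function

set_option linter.dupNamespace false

namespace Summit.SmoothPoincare4.SmoothPoincare4.Theorems.CylinderEntropySliceIsolation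

/-! ### Coordinates of `ℝ⁶`: the first five and the height -/

/-- Two vectors of `ℝ⁶` with the same first five coordinates and the same height coincide (every
index of `Fin 6` is `Fin.castSucc i`, `i : Fin 5`, or the last one `5`). [folklore] -/
theorem ext_castSucc_five {a b : EuclideanSpace ℝ (Fin 6)}
    (h : ∀ i : Fin 5, a (Fin.castSucc i) = b (Fin.castSucc i)) (h5 : a 5 = b 5) : a = b := by
  ext j
  induction j using Fin.lastCases with
  | last => exact h5
  | cast i => exact h i

/-! ### The map `Φ z = e^{z₅} z'` : smoothness and its differential -/

/-- `Φ : ℝ⁶ → ℝ⁵`, `z ↦ e^{z₅} (z₀, …, z₄)`, is `C^∞` (products of the smooth functions `exp ∘ z₅`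
and the coordinates). [folklore] -/
theorem contDiff_conformalFun :
    ContDiff ℝ ∞ (fun z : EuclideanSpace ℝ (Fin 6) =>
      (WithLp.toLp 2 (fun i : Fin 5 => Real.exp (z 5) * z (Fin.castSucc i)) : EuclideanSpace ℝ (Fin 5))) := by
  refine contDiff_piLp' 2 fun i => ?_
  exact (Real.contDiff_exp.comp (contDiff_piLp_apply (𝕜 := ℝ) 2)).mul (contDiff_piLp_apply (𝕜 := ℝ) 2)

/-- The `i`-th component `z ↦ e^{z₅} zᵢ` of `Φ` has derivative `v ↦ e^{z₅} vᵢ + zᵢ e^{z₅} v₅`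
(product and chain rules). [folklore] -/
theorem hasFDerivAt_expMulCoord (z : EuclideanSpace ℝ (Fin 6)) (i : Fin 5) :
    HasFDerivAt (fun z : EuclideanSpace ℝ (Fin 6) => Real.exp (z 5) * z (Fin.castSucc i))
      (Real.exp (z 5) • PiLp.proj (𝕜 := ℝ) 2 (fun _ : Fin 6 => ℝ) (Fin.castSucc i) +
        z (Fin.castSucc i) • (Real.exp (z 5) • PiLp.proj (𝕜 := ℝ) 2 (fun _ : Fin 6 => ℝ) 5)) z := by
  have h5 : HasFDerivAt (fun z : EuclideanSpace ℝ (Fin 6) => z 5)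
      (PiLp.proj (𝕜 := ℝ) 2 (fun _ : Fin 6 => ℝ) 5) z :=
    PiLp.hasFDerivAt_apply (𝕜 := ℝ) 2 z 5
  have hi : HasFDerivAt (fun z : EuclideanSpace ℝ (Fin 6) => z (Fin.castSucc i))
      (PiLp.proj (𝕜 := ℝ) 2 (fun _ : Fin 6 => ℝ) (Fin.castSucc i)) z :=
    PiLp.hasFDerivAt_apply (𝕜 := ℝ) 2 z (Fin.castSucc i)
  have hexp := (Real.hasDerivAt_exp (z 5)).comp_hasFDerivAt z h5
  exact hexp.mul hi

/-- **Coordinates of the differential of `Φ`**: `(dΦ_z v)ᵢ = e^{z₅} vᵢ + zᵢ (e^{z₅} v₅)`. [folklore] -/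
theorem fderiv_conformalFun_apply (z v : EuclideanSpace ℝ (Fin 6)) (i : Fin 5) :
    (fderiv ℝ (fun z : EuclideanSpace ℝ (Fin 6) =>
      (WithLp.toLp 2 (fun i : Fin 5 => Real.exp (z 5) * z (Fin.castSucc i)) : EuclideanSpace ℝ (Fin 5)))
        z v) i =
      Real.exp (z 5) * v (Fin.castSucc i) + z (Fin.castSucc i) * (Real.exp (z 5) * v 5) := by
  have hd : HasFDerivAt (fun z : EuclideanSpace ℝ (Fin 6) =>
      (WithLp.toLp 2 (fun i : Fin 5 => Real.exp (z 5) * z (Fin.castSucc i)) : EuclideanSpace ℝ (Fin 5)))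
      (fderiv ℝ (fun z : EuclideanSpace ℝ (Fin 6) =>
        (WithLp.toLp 2 (fun i : Fin 5 => Real.exp (z 5) * z (Fin.castSucc i)) :
          EuclideanSpace ℝ (Fin 5))) z) z :=
    ((contDiff_conformalFun.differentiable (by simp)) z).hasFDerivAt
  have h1 := (PiLp.hasFDerivAt_apply (𝕜 := ℝ) 2
    ((WithLp.toLp 2 (fun i : Fin 5 => Real.exp (z 5) * z (Fin.castSucc i)) : EuclideanSpace ℝ (Fin 5)))
    i).comp z hd
  have h2 : HasFDerivAt (fun y : EuclideanSpace ℝ (Fin 6) =>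
      ((WithLp.toLp 2 (fun i : Fin 5 => Real.exp (y 5) * y (Fin.castSucc i)) : EuclideanSpace ℝ (Fin 5))) i)
      (Real.exp (z 5) • PiLp.proj (𝕜 := ℝ) 2 (fun _ : Fin 6 => ℝ) (Fin.castSucc i) +
        z (Fin.castSucc i) • (Real.exp (z 5) • PiLp.proj (𝕜 := ℝ) 2 (fun _ : Fin 6 => ℝ) 5)) z :=
    hasFDerivAt_expMulCoord z i
  have h12 := h1.unique h2
  have h := DFunLike.congr_fun h12 v
  simpa using h

/-! ### The constraint `q z = ∑_{i<5} zᵢ² = 1` and its differential -/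

/-- `q z = ∑_{i<5} zᵢ²` has derivative `∑ᵢ (2 zᵢ) dzᵢ`. [folklore] -/
theorem hasFDerivAt_sumSq (z : EuclideanSpace ℝ (Fin 6)) :
    HasFDerivAt (fun z : EuclideanSpace ℝ (Fin 6) => ∑ i : Fin 5, z (Fin.castSucc i) ^ 2)
      (∑ i : Fin 5, (2 • z (Fin.castSucc i) ^ (2 - 1)) •
        PiLp.proj (𝕜 := ℝ) 2 (fun _ : Fin 6 => ℝ) (Fin.castSucc i)) z :=
  HasFDerivAt.fun_sum fun i _ => (PiLp.hasFDerivAt_apply (𝕜 := ℝ) 2 z (Fin.castSucc i)).pow 2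

/-- **The differential of `q`**: `dq_z v = 2 ∑_{i<5} zᵢ vᵢ`. [folklore] -/
theorem fderiv_sumSq_apply (z v : EuclideanSpace ℝ (Fin 6)) :
    fderiv ℝ (fun z : EuclideanSpace ℝ (Fin 6) => ∑ i : Fin 5, z (Fin.castSucc i) ^ 2) z v =
      2 * ∑ i : Fin 5, z (Fin.castSucc i) * v (Fin.castSucc i) := by
  rw [(hasFDerivAt_sumSq z).fderiv, Finset.mul_sum]
  simp only [FunLike.coe_sum, Finset.sum_apply, FunLike.coe_smul, Pi.smul_apply, PiLp.proj_apply,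
    smul_eq_mul]
  refine Finset.sum_congr rfl fun i _ => ?_
  simp only [nsmul_eq_mul]
  norm_num
  ring

/-! ### Algebra on `N`: injectivity of `Φ|_N` and of its differential on `T N` -/

/-- **`Φ` is injective on `N`**: if `e^{a₅} a' = e^{b₅} b'` with `|a'| = |b'| = 1` then `a = b`
(compare `∑` of squares to get `e^{2a₅} = e^{2b₅}`). [folklore] -/
theorem eq_of_conformal_eq {a b : EuclideanSpace ℝ (Fin 6)}
    (ha : ∑ i : Fin 5, a (Fin.castSucc i) ^ 2 = 1) (hb : ∑ i : Fin 5, b (Fin.castSucc i) ^ 2 = 1)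
    (h : ∀ i : Fin 5, Real.exp (a 5) * a (Fin.castSucc i) = Real.exp (b 5) * b (Fin.castSucc i)) :
    a = b := by
  have hsq : Real.exp (a 5) ^ 2 = Real.exp (b 5) ^ 2 := by
    calc Real.exp (a 5) ^ 2 = ∑ i : Fin 5, (Real.exp (a 5) * a (Fin.castSucc i)) ^ 2 := by
          simp_rw [mul_pow]; rw [← Finset.mul_sum, ha, mul_one]
      _ = ∑ i : Fin 5, (Real.exp (b 5) * b (Fin.castSucc i)) ^ 2 := by simp_rw [h]
      _ = Real.exp (b 5) ^ 2 := by simp_rw [mul_pow]; rw [← Finset.mul_sum, hb, mul_one]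
  have h5 : a 5 = b 5 :=
    Real.exp_injective ((sq_eq_sq₀ (Real.exp_pos _).le (Real.exp_pos _).le).1 hsq)
  refine ext_castSucc_five (fun i => ?_) h5
  have hi := h i
  rw [h5] at hi
  exact mul_left_cancel₀ (Real.exp_ne_zero _) hi

/-- **`dΦ_z` is injective on `T_z N`**: if `∑ zᵢ² = 1`, `∑ zᵢ vᵢ = 0` and all the coordinates
`e^{z₅} vᵢ + zᵢ (e^{z₅} v₅)` of `dΦ_z v` vanish, then `v = 0` (`vᵢ = -zᵢ v₅`, so
`0 = ∑ zᵢ vᵢ = -v₅`). [folklore] -/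
theorem eq_zero_of_conformal_differential_eq_zero {z v : EuclideanSpace ℝ (Fin 6)}
    (hz : ∑ i : Fin 5, z (Fin.castSucc i) ^ 2 = 1)
    (hv : ∑ i : Fin 5, z (Fin.castSucc i) * v (Fin.castSucc i) = 0)
    (h0 : ∀ i : Fin 5,
      Real.exp (z 5) * v (Fin.castSucc i) + z (Fin.castSucc i) * (Real.exp (z 5) * v 5) = 0) :
    v = 0 := by
  have h1 : ∀ i : Fin 5, v (Fin.castSucc i) = -(z (Fin.castSucc i) * v 5) := by
    intro i
    have h : Real.exp (z 5) * (v (Fin.castSucc i) + z (Fin.castSucc i) * v 5) = 0 := by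
      rw [← h0 i]; ring
    have h' := (mul_eq_zero.1 h).resolve_left (Real.exp_ne_zero _)
    linarith
  have h5 : v 5 = 0 := by
    have hsum : ∑ i : Fin 5, z (Fin.castSucc i) * v (Fin.castSucc i) =
        -(v 5) * ∑ i : Fin 5, z (Fin.castSucc i) ^ 2 := by
      rw [Finset.mul_sum]
      exact Finset.sum_congr rfl fun i _ => by rw [h1 i]; ring
    rw [hv, hz] at hsum
    linarith
  refine ext_castSucc_five (fun i => ?_) (by simpa using h5)
  rw [h1 i, h5]
  simp

/-! ### The stub -/

/-- **`Φ ∘ ι` is a smooth embedding into `ℝ⁵`.** For a compact `4`-manifold `M` and a smooth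
embedding `ι : M → ℝ⁶` with image in the round cylinder `N = {∑_{i<5} zᵢ² = 1}`, the composite of `ι`
with `Φ z = e^{z₅} (z₀, …, z₄)` is a smooth embedding `M → ℝ⁵`: it is `C^∞`, injective (`Φ|_N` is
injective) with injective differential (`dΦ` is injective on `T N ⊇ range dι`), and `M` is compact
(tree: `Literature.Topology.FourManifolds.isSmoothEmbedding_of_injective_of_injective_mfderiv`,
Hirsch (1976) Ch. 1 §3 Thm. 3.1). Registered statement of stub `stub_conformalEmbedding` of line
`conformal-kernel-domination`, crux `CylinderEntropy.SliceIsolation`. [folklore] -/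
theorem stub_conformalEmbedding :
    ∀ (M : Type) [TopologicalSpace M] [T2Space M] [SecondCountableTopology M]
      [ChartedSpace (EuclideanSpace ℝ (Fin 4)) M] [IsManifold (𝓡 4) ∞ M] [CompactSpace M]
      (ι : M → EuclideanSpace ℝ (Fin 6)), Manifold.IsSmoothEmbedding (𝓡 4) (𝓡 6) ∞ ι →
      (∀ x, ∑ i : Fin 5, ι x (Fin.castSucc i) ^ 2 = 1) →
      Manifold.IsSmoothEmbedding (𝓡 4) (𝓡 5) ∞
        ((fun z : EuclideanSpace ℝ (Fin 6) =>
          (WithLp.toLp 2 (fun i : Fin 5 => Real.exp (z 5) * z (Fin.castSucc i)) : EuclideanSpace ℝ (Fin 5))) ∘ ι) := by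
  intro M _ _ _ _ _ _ ι hι hN
  set Ψ : EuclideanSpace ℝ (Fin 6) → EuclideanSpace ℝ (Fin 5) := fun z =>
    (WithLp.toLp 2 (fun i : Fin 5 => Real.exp (z 5) * z (Fin.castSucc i)) : EuclideanSpace ℝ (Fin 5))
    with hΨ
  have hΨs : ContDiff ℝ ∞ Ψ := contDiff_conformalFun
  have hιs : ContMDiff (𝓡 4) (𝓡 6) ∞ ι := hι.contMDiff
  have hf : ContMDiff (𝓡 4) (𝓡 5) ∞ (Ψ ∘ ι) := hΨs.comp_contMDiff hιs
  refine Literature.Topology.FourManifolds.isSmoothEmbedding_of_injective_of_injective_mfderiv hf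
    (by norm_num) ?_ ?_
  · -- injectivity
    intro x y hxy
    apply hι.isEmbedding.injective
    refine eq_of_conformal_eq (hN x) (hN y) fun i => ?_
    have h := congrArg (fun w : EuclideanSpace ℝ (Fin 5) => w i) hxy
    simpa [hΨ] using h
  · -- injectivity of the differential
    intro x
    have h1 : HasMFDerivAt (𝓡 4) (𝓡 6) ι x (mfderiv (𝓡 4) (𝓡 6) ι x) :=
      ((hιs x).mdifferentiableAt (by simp)).hasMFDerivAt
    have hΨd : HasFDerivAt Ψ (fderiv ℝ Ψ (ι x)) (ι x) :=
      ((hΨs.differentiable (by simp)) (ι x)).hasFDerivAt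
    have h3 := hΨd.hasMFDerivAt.comp x h1
    rw [h3.mfderiv]
    have hDι : Injective (mfderiv (𝓡 4) (𝓡 6) ι x) :=
      Literature.Topology.FourManifolds.mfderiv_injective_of_isImmersion hι.isImmersion (by simp) x
    -- the range of `dι_x` is tangent to `N`
    have hqd : HasFDerivAt (fun z : EuclideanSpace ℝ (Fin 6) => ∑ i : Fin 5, z (Fin.castSucc i) ^ 2)
        (fderiv ℝ (fun z : EuclideanSpace ℝ (Fin 6) => ∑ i : Fin 5, z (Fin.castSucc i) ^ 2) (ι x))
        (ι x) :=
      (hasFDerivAt_sumSq (ι x)).differentiableAt.hasFDerivAt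
    have hc := hqd.hasMFDerivAt.comp x h1
    have e1 := hc.mfderiv
    have e2 : mfderiv (𝓡 4) 𝓘(ℝ, ℝ)
        ((fun z : EuclideanSpace ℝ (Fin 6) => ∑ i : Fin 5, z (Fin.castSucc i) ^ 2) ∘ ι) x = 0 := by
      have hfun : ((fun z : EuclideanSpace ℝ (Fin 6) => ∑ i : Fin 5, z (Fin.castSucc i) ^ 2) ∘ ι) =
          fun _ => (1 : ℝ) := funext fun x' => hN x'
      rw [hfun]
      exact mfderiv_const
    have heq := e1.symm.trans e2
    refine (injective_iff_map_eq_zero _).2 fun w hw => ?_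
    have hv : (mfderiv (𝓡 4) (𝓡 6) ι x w : EuclideanSpace ℝ (Fin 6)) = 0 := by
      refine eq_zero_of_conformal_differential_eq_zero (hN x) ?_ fun i => ?_
      · have h := DFunLike.congr_fun heq w
        have h' : fderiv ℝ (fun z : EuclideanSpace ℝ (Fin 6) => ∑ i : Fin 5, z (Fin.castSucc i) ^ 2)
            (ι x) (mfderiv (𝓡 4) (𝓡 6) ι x w : EuclideanSpace ℝ (Fin 6)) = 0 := h
        rw [fderiv_sumSq_apply] at h'
        linarith
      · have h' : fderiv ℝ Ψ (ι x) (mfderiv (𝓡 4) (𝓡 6) ι x w : EuclideanSpace ℝ (Fin 6)) = 0 := hw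
        have h'' := congrArg (fun u : EuclideanSpace ℝ (Fin 5) => u i) h'
        simpa only [hΨ, fderiv_conformalFun_apply, PiLp.zero_apply] using h''
    exact (injective_iff_map_eq_zero _).1 hDι w hv

end Summit.SmoothPoincare4.SmoothPoincare4.Theorems.CylinderEntropySliceIsolation
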